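import Summits.QuantumFields.Balaban3D.Proofs.Run3Representation
import Summits.QuantumFields.Balaban3D.Proofs.NewbornJet
import Summits.QuantumFields.Balaban3D.Proofs.NewbornCount

/-!
# Bałaban CMP 102 (1985) 255–275, d = 3 — prover seat p6 (lane `pub-balaban3d`): the NEWBORN SLICE of (46) at
# the lane's step pieces (ruling R-46N) — what the C5/C7 inputs give for `|PY_k h U + PYZ_k h U|`, the terms of
# `Pint (k+1) = PoldIn_k + PY_k + PYZ_k` born at step k, in EXACT currency (the contract form in print's currency,
# modulo the GAP binder G3D-08, is the sibling `…Proofs.Newborn46`)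

Source: T. Bałaban, Commun. Math. Phys. **102** (1985) 255–275 [Balaban1985UV3] (= [B10]); loci in the sibling
`…Proofs.NewbornJet` ((30)/(34) pp. 263–264, (44)–(46) p. 267, p. 265 L14–16) and p. 266 (43) «y represents big
blocks of L^jη-lattice, contained in Ω_k».

HONEST FRAMING (lane PLAN.md §0).  [B10] proves UV stability of the d = 3 lattice gauge theory on a finite torus —
NOT a continuum limit, NOT infinite volume, NOT a mass gap, NOT d = 4, NOT Clay.  Nothing of the paper is asserted:
`newborn46Raw_series` says «IF the expansion data `𝔖 k` satisfy the (α) inputs of the representation leaves C5/C7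
(G3D-01 `chart` at the (25)-rate, (28) `bound28`/`small28`, G3D-06 `far_le`, the identification `hPY`; «(63) as
cited» `Λ : LogZLocalization` = G3D-07 via `LogZLocalization.ofCited`, the identification `hPYZ`), THEN the newborn
terms obey the displayed bound with the volume `|Λ_{k+1}| = #LamFin` of seat p1's `Carriers.Regions`» — the
perturbative half in print's currency `g_k²p(g_k)²` (`newbornY46_series`), the (61)-born half in the currency
`(r(g_k)g_kp(g_k))²` the inputs actually give (`newbornZ46r_series`; the factor `r(g_k)²` over print's (46) is the
lane FINDING of 2026-08-22 recorded in `…Proofs.NewbornJet`; the lane closes it with the GAP binder G3D-08 in the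
sibling `…Proofs.Newborn46`).  The block count is the sibling `…Proofs.NewbornCount` (seat p1's regions).
PLACEMENT: lane cell topic `Summits/QuantumFields/Balaban3D/Proofs/`.  Record: HOME `run/shared/lean/pub/pub-balaban3d/`.
-/

noncomputable section

open scoped Topology
open Metric Set Finset MeasureTheory
open Literature.MathematicalPhysics.QuantumFieldTheory.Balaban1983to89
open Literature.MathematicalPhysics.QuantumFieldTheory.Balaban1983to89.B10
open Literature.MathematicalPhysics.QuantumFieldTheory.Balaban1983to89.B10SectAGathering
open Literature.MathematicalPhysics.QuantumFieldTheory.Balaban1983to89.B10Assembly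
open Literature.MathematicalPhysics.QuantumFieldTheory.Balaban1983to89.B12TreeDecay (kappa₀ K₀ K₀_pos)
open Literature.MathematicalPhysics.QuantumFieldTheory.Balaban1983to89.TreeLengthTorus (tsys tcubeSys TPt)
open Literature.MathematicalPhysics.QuantumFieldTheory.Balaban1985CMP102
open Literature.MathematicalPhysics.QuantumFieldTheory.Balaban1985CMP102.Setting
open Literature.MathematicalPhysics.QuantumFieldTheory.Balaban1985CMP102.Binders
  (ChartAnalyticityAsCited FarTermsDecayAsCited)
open Summit.QuantumFields.Balaban3D.Proofs.Representation33
open Summit.QuantumFields.Balaban3D.Proofs.LogZLocalized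
open Summit.QuantumFields.Balaban3D.Proofs.NewbornJet
open Summit.QuantumFields.Balaban3D.Proofs.NewbornCount
open Summit.QuantumFields.Balaban3D.Proofs.Run3Representation
open Summit.QuantumFields.Balaban3D.Carriers
open Summit.QuantumFields.Balaban3D.Proofs.ScalesArithmetic

namespace Summit.QuantumFields.Balaban3D.Proofs.Run3Newborn

/-! ## The newborn terms at the series' pieces, exact currency -/

section Series

variable {L : ℕ} {S : Scales L} {G : Type} [GaugeGroup G] [MeasurableSpace G] [HaarData G]
  {V : Type} [NormedAddCommGroup V] [NormedSpace ℂ V] [FiniteDimensional ℂ V] {Nc : ℕ → ℕ} [∀ k, NeZero (Nc k)]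
  (B : TowerBase S G) (𝔖 : ∀ k, StepSeries S G V (Nc k) k) (C : ∀ k, PiecesParams S k) (k : ℕ)

/-- The block count at the lane's scales in real form: `#ΩblkOf ≤ L³·#LamFin` (`card_ΩblkOf_le`, `d = 3`). [folklore] -/
theorem card_ΩblkOf_le_real (hk1 : k + 1 ≤ S.P.m + S.P.K) (hN : Nc k = max 1 (S.P.sitesPerDir k / B.M₁))
    (h : Hist S.P (k + 1)) :
    ((ΩblkOf B.M₁ B.Rcol (Nc k) h).card : ℝ) ≤ (L : ℝ) ^ 3 * ((LamFin B.M₁ B.Rcol k h).card : ℝ) := by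
  have hc : (ΩblkOf B.M₁ B.Rcol (Nc k) h).card ≤ L ^ 3 * (LamFin B.M₁ B.Rcol k h).card :=
    card_ΩblkOf_le B.M₁ B.Rcol hk1 (Nc k) hN h
  exact_mod_cast hc

omit [FiniteDimensional ℂ V] in
/-- The retained localizations lie inside the blocks of `Ω_{k+1}(h)` (the first conjunct of seat p1's `StepSeries.loc`). [folklore] -/
theorem cubes_subset_of_mem_loc (h : Hist S.P (k + 1)) :
    ∀ X ∈ (𝔖 k).loc (ΩblkOf B.M₁ B.Rcol (Nc k)) (B.Rret k) h,
      (tcubeSys 3 (Nc k)).cubes X ⊆ ΩblkOf B.M₁ B.Rcol (Nc k) h := by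
  intro X hX
  rw [TreeLengthTorus.tcubeSys_cubes]
  exact (Finset.mem_filter.1 hX).2.1

/-- **The perturbative newborn terms `PY_k`, exact currency**: from C5's inputs (G3D-01 at the (25)-rate, (28),
G3D-06, `hPY`), `|PY_k h U| ≤ (20(s/ρ)² + Cfar·g_k⁷(r p)⁷)·(C25·g_k)·K₀(32,6)·L³·#LamFin`, `s = cB·r(g_k)g_kp(g_k)`.
[cite: Balaban1985UV3, (46) p.267 + (33)–(34) p.264] -/
theorem abs_PY_le_series (hk : k ≤ S.K) (hk1 : k + 1 ≤ S.P.m + S.P.K) (κc : ChartConsts) {κ C25 : ℝ}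
    (hκ : kappa₀ (4 * 2 ^ 3) (2 * 3) ≤ κ) (hC25 : 0 ≤ C25) (hb₀ : 0 ≤ B.b₀)
    (hN : Nc k = max 1 (S.P.sitesPerDir k / B.M₁))
    (chart : ∀ X, ChartAnalyticityAsCited ((𝔖 k).Ψ X) κc.ρ
      (C25 * S.gk k * Real.exp (-(κ * (tsys 3 (Nc k)).dj X))))
    (bound28 : ∀ X h U, ‖(𝔖 k).Bcfg X h U‖ ≤ κc.cB * (rFun κc.r₀ (S.gk k) * S.gk k * pFun B.b₀ B.p₀ (S.gk k)))
    (small28 : κc.cB * (rFun κc.r₀ (S.gk k) * S.gk k * pFun B.b₀ B.p₀ (S.gk k)) ≤ κc.ρ / 4)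
    (far_le : FarTermsDecayAsCited (𝔖 k).far (fun X => C25 * S.gk k * Real.exp (-(κ * (tsys 3 (Nc k)).dj X)))
      κc.Cfar (S.gk k ^ 7 * (rFun κc.r₀ (S.gk k) * pFun B.b₀ B.p₀ (S.gk k)) ^ 7))
    (hPY : ∀ h U, (𝔖 k).PY h U
      = ∑ X ∈ (𝔖 k).loc (ΩblkOf B.M₁ B.Rcol (Nc k)) (B.Rret k) h,
          ((jet26 ((𝔖 k).Ψ X) ((𝔖 k).Bcfg X h U)).re - (𝔖 k).far X h U))
    (h : Hist S.P (k + 1)) (U : GaugeField S.P (k + 1) G) :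
    |(𝔖 k).PY h U|
      ≤ (20 * (κc.cB * (rFun κc.r₀ (S.gk k) * S.gk k * pFun B.b₀ B.p₀ (S.gk k)) / κc.ρ) ^ 2
            + κc.Cfar * (S.gk k ^ 7 * (rFun κc.r₀ (S.gk k) * pFun B.b₀ B.p₀ (S.gk k)) ^ 7))
          * ((C25 * S.gk k) * K₀ (4 * 2 ^ 3) (2 * 3) * ((L : ℝ) ^ 3 * ((LamFin B.M₁ B.Rcol k h).card : ℝ))) := by
  have hg0 : 0 < S.gk k := gk_pos S k
  have hg1 : S.gk k ≤ 1 := gk_le_one S S.gK_le_one k hk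
  have hs0 := bound28_rhs_nonneg (r₀ := κc.r₀) (p₀ := B.p₀) κc.cB_nonneg hb₀ hg0 hg1
  have hC : 0 ≤ C25 * S.gk k := mul_nonneg hC25 hg0.le
  have hc7 : 0 ≤ κc.Cfar * (S.gk k ^ 7 * (rFun κc.r₀ (S.gk k) * pFun B.b₀ B.p₀ (S.gk k)) ^ 7) := by
    have hu := log_inv_nonneg_of_le_one hg0 hg1; have hp := pFun_nonneg B.b₀ B.p₀ (S.gk k) hb₀ hg0 hg1
    have hr : 0 ≤ rFun κc.r₀ (S.gk k) := by unfold rFun; exact Real.rpow_nonneg (by linarith) _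
    have := κc.Cfar_nonneg; positivity
  have hmain := abs_sum_jet_sub_far_le (E := (𝔖 k).E) (tcubeSys 3 (Nc k)) (TreeLengthTorus.tdegreeLE 3 _)
    (TreeLengthTorus.tvolumeLeaf 3 _) hκ hC (𝔖 k).Ψ
    (fun X => C25 * S.gk k * Real.exp (-(κ * (tsys 3 (Nc k)).dj X))) chart (fun X => le_rfl) (𝔖 k).Bcfg hs0
    small28 bound28 (𝔖 k).far far_le hc7 (ΩblkOf B.M₁ B.Rcol (Nc k) h)
    ((𝔖 k).loc (ΩblkOf B.M₁ B.Rcol (Nc k)) (B.Rret k) h) (cubes_subset_of_mem_loc B 𝔖 k h) h U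
  rw [hPY h U]
  refine hmain.trans (mul_le_mul_of_nonneg_left ?_ (by positivity))
  have hK : 0 ≤ C25 * S.gk k * K₀ (4 * 2 ^ 3) (2 * 3) := mul_nonneg hC (K₀_pos _ _).le
  calc C25 * S.gk k * K₀ (4 * 2 ^ 3) (2 * 3) * ((ΩblkOf B.M₁ B.Rcol (Nc k) h).card : ℝ)
      ≤ C25 * S.gk k * K₀ (4 * 2 ^ 3) (2 * 3) * ((L : ℝ) ^ 3 * ((LamFin B.M₁ B.Rcol k h).card : ℝ)) :=
        mul_le_mul_of_nonneg_left (card_ΩblkOf_le_real B k hk1 hN h) hK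

/-- **The (61)-born newborn terms `PYZ_k`, exact currency**: from C7's inputs («(63) as cited» `Λ : LogZLocalization`
= G3D-07 by `ofCited`, (28), `hPYZ`), `|PYZ_k h U| ≤ (20(s/ρ)² + Cfar·g_k⁷(r p)⁷)·C63·K₀(32,6)·L³·#LamFin` — the
amplitude `C63` is g-FREE (p. 265 L15). [cite: Balaban1985UV3, (46) p.267 + (61) p.271 + p.265 L14–16] -/
theorem abs_PYZ_le_series (hk : k ≤ S.K) (hk1 : k + 1 ≤ S.P.m + S.P.K) (κc : ChartConsts) {κ C63 : ℝ}
    (hκ : kappa₀ (4 * 2 ^ 3) (2 * 3) ≤ κ) (hC63 : 0 ≤ C63) (hb₀ : 0 ≤ B.b₀)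
    (hN : Nc k = max 1 (S.P.sitesPerDir k / B.M₁))
    (bound28 : ∀ X h U, ‖(𝔖 k).Bcfg X h U‖ ≤ κc.cB * (rFun κc.r₀ (S.gk k) * S.gk k * pFun B.b₀ B.p₀ (S.gk k)))
    (small28 : κc.cB * (rFun κc.r₀ (S.gk k) * S.gk k * pFun B.b₀ B.p₀ (S.gk k)) ≤ κc.ρ / 4)
    (Λ : LogZLocalization (B.withSeries 𝔖 C).tower3.toTowerRun k (𝔖 k).E κc κ C63
      (seriesPieces B 𝔖 C k).logZU (seriesPieces B 𝔖 C k).logZ1 (𝔖 k).Bcfg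
      (fun h => Finset.univ.filter fun X : (tsys 3 (Nc k)).Dom => X.1 ⊆ ΩblkOf B.M₁ B.Rcol (Nc k) h))
    (hPYZ : ∀ h U, (𝔖 k).PYZ h U
      = ∑ X ∈ (𝔖 k).loc (ΩblkOf B.M₁ B.Rcol (Nc k)) (B.Rret k) h,
          ((jet26 (Λ.Ψ X) ((𝔖 k).Bcfg X h U)).re - Λ.far X h U))
    (h : Hist S.P (k + 1)) (U : GaugeField S.P (k + 1) G) :
    |(𝔖 k).PYZ h U|
      ≤ (20 * (κc.cB * (rFun κc.r₀ (S.gk k) * S.gk k * pFun B.b₀ B.p₀ (S.gk k)) / κc.ρ) ^ 2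
            + κc.Cfar * (S.gk k ^ 7 * (rFun κc.r₀ (S.gk k) * pFun B.b₀ B.p₀ (S.gk k)) ^ 7))
          * (C63 * K₀ (4 * 2 ^ 3) (2 * 3) * ((L : ℝ) ^ 3 * ((LamFin B.M₁ B.Rcol k h).card : ℝ))) := by
  have hg0 : 0 < S.gk k := gk_pos S k
  have hg1 : S.gk k ≤ 1 := gk_le_one S S.gK_le_one k hk
  have hs0 := bound28_rhs_nonneg (r₀ := κc.r₀) (p₀ := B.p₀) κc.cB_nonneg hb₀ hg0 hg1
  have hc7 : 0 ≤ κc.Cfar * (S.gk k ^ 7 * (rFun κc.r₀ (S.gk k) * pFun B.b₀ B.p₀ (S.gk k)) ^ 7) := by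
    have hu := log_inv_nonneg_of_le_one hg0 hg1; have hp := pFun_nonneg B.b₀ B.p₀ (S.gk k) hb₀ hg0 hg1
    have hr : 0 ≤ rFun κc.r₀ (S.gk k) := by unfold rFun; exact Real.rpow_nonneg (by linarith) _
    have := κc.Cfar_nonneg; positivity
  have hmain := abs_sum_jet_sub_far_le (E := (𝔖 k).E) (tcubeSys 3 (Nc k)) (TreeLengthTorus.tdegreeLE 3 _)
    (TreeLengthTorus.tvolumeLeaf 3 _) hκ hC63 Λ.Ψ
    (fun X => C63 * Real.exp (-(κ * (tsys 3 (Nc k)).dj X))) Λ.chart (fun X => le_rfl) (𝔖 k).Bcfg hs0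
    small28 bound28 Λ.far Λ.far_le hc7 (ΩblkOf B.M₁ B.Rcol (Nc k) h)
    ((𝔖 k).loc (ΩblkOf B.M₁ B.Rcol (Nc k)) (B.Rret k) h) (cubes_subset_of_mem_loc B 𝔖 k h) h U
  rw [hPYZ h U]
  refine hmain.trans (mul_le_mul_of_nonneg_left ?_ (by positivity))
  have hK : 0 ≤ C63 * K₀ (4 * 2 ^ 3) (2 * 3) := mul_nonneg hC63 (K₀_pos _ _).le
  exact mul_le_mul_of_nonneg_left (card_ΩblkOf_le_real B k hk1 hN h) hK

/-- **THE NEWBORN SLICE of (46), EXACT CURRENCY, at `seriesPieces B 𝔖 C k`** (lane ruling R-46N): from exactly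
the inputs of the representation leaves C5 (`repr33_60_series`: G3D-01 `chart`, (28) `bound28`/`small28`, G3D-06
`far_le`, `hPY`) and C7 (`decomp35_61_series`: «(63) as cited» `Λ`, `hPYZ`), for every history and field,
`|PY_k h U + PYZ_k h U| ≤ K₀(32,6)·L³·|Λ_{k+1}(h)|·(C25·g_k + C63)·(20(cB·r(g_k)g_kp(g_k)/ρ)² + Cfar·g_k⁷(r(g_k)
p(g_k))⁷)` with `|Λ_{k+1}(h)| = #LamFin M₁ Rcol k h` (seat p1, R-LAMVOL).  No (32)/(26) is needed (the jets have no
first-order term).  The perturbative part is print's `O(1)·g_k²p(g_k)²` (`newbornY46_series`); the (61)-born part carries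
`r(g_k)²` over print's (46) (`newbornZ46r_series`; lane FINDING). [cite: Balaban1985UV3, (46) p.267 + (33)–(34) p.264 + (61) p.271] -/
theorem newborn46Raw_series (hk : k ≤ S.K) (hk1 : k + 1 ≤ S.P.m + S.P.K) (κc : ChartConsts) {κ C25 C63 : ℝ}
    (hκ : kappa₀ (4 * 2 ^ 3) (2 * 3) ≤ κ) (hC25 : 0 ≤ C25) (hC63 : 0 ≤ C63) (hb₀ : 0 ≤ B.b₀)
    (hN : Nc k = max 1 (S.P.sitesPerDir k / B.M₁))
    (chart : ∀ X, ChartAnalyticityAsCited ((𝔖 k).Ψ X) κc.ρ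
      (C25 * S.gk k * Real.exp (-(κ * (tsys 3 (Nc k)).dj X))))
    (bound28 : ∀ X h U, ‖(𝔖 k).Bcfg X h U‖ ≤ κc.cB * (rFun κc.r₀ (S.gk k) * S.gk k * pFun B.b₀ B.p₀ (S.gk k)))
    (small28 : κc.cB * (rFun κc.r₀ (S.gk k) * S.gk k * pFun B.b₀ B.p₀ (S.gk k)) ≤ κc.ρ / 4)
    (far_le : FarTermsDecayAsCited (𝔖 k).far (fun X => C25 * S.gk k * Real.exp (-(κ * (tsys 3 (Nc k)).dj X)))
      κc.Cfar (S.gk k ^ 7 * (rFun κc.r₀ (S.gk k) * pFun B.b₀ B.p₀ (S.gk k)) ^ 7))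
    (hPY : ∀ h U, (𝔖 k).PY h U
      = ∑ X ∈ (𝔖 k).loc (ΩblkOf B.M₁ B.Rcol (Nc k)) (B.Rret k) h,
          ((jet26 ((𝔖 k).Ψ X) ((𝔖 k).Bcfg X h U)).re - (𝔖 k).far X h U))
    (Λ : LogZLocalization (B.withSeries 𝔖 C).tower3.toTowerRun k (𝔖 k).E κc κ C63
      (seriesPieces B 𝔖 C k).logZU (seriesPieces B 𝔖 C k).logZ1 (𝔖 k).Bcfg
      (fun h => Finset.univ.filter fun X : (tsys 3 (Nc k)).Dom => X.1 ⊆ ΩblkOf B.M₁ B.Rcol (Nc k) h))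
    (hPYZ : ∀ h U, (𝔖 k).PYZ h U
      = ∑ X ∈ (𝔖 k).loc (ΩblkOf B.M₁ B.Rcol (Nc k)) (B.Rret k) h,
          ((jet26 (Λ.Ψ X) ((𝔖 k).Bcfg X h U)).re - Λ.far X h U))
    (h : Hist S.P (k + 1)) (U : GaugeField S.P (k + 1) G) :
    |(𝔖 k).PY h U + (𝔖 k).PYZ h U|
      ≤ K₀ (4 * 2 ^ 3) (2 * 3) * ((L : ℝ) ^ 3 * ((LamFin B.M₁ B.Rcol k h).card : ℝ))
          * ((C25 * S.gk k + C63)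
            * (20 * (κc.cB * (rFun κc.r₀ (S.gk k) * S.gk k * pFun B.b₀ B.p₀ (S.gk k)) / κc.ρ) ^ 2
                + κc.Cfar * (S.gk k ^ 7 * (rFun κc.r₀ (S.gk k) * pFun B.b₀ B.p₀ (S.gk k)) ^ 7))) := by
  have hY := abs_PY_le_series B 𝔖 k hk hk1 κc hκ hC25 hb₀ hN chart bound28 small28 far_le hPY h U
  have hZ := abs_PYZ_le_series B 𝔖 C k hk hk1 κc hκ hC63 hb₀ hN bound28 small28 Λ hPYZ h U
  calc |(𝔖 k).PY h U + (𝔖 k).PYZ h U| ≤ |(𝔖 k).PY h U| + |(𝔖 k).PYZ h U| := abs_add_le _ _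
    _ ≤ _ := add_le_add hY hZ
    _ = _ := by ring

/-- **The perturbative newborn terms in PRINT'S CURRENCY** `O(1)·g_k²p(g_k)²·|Λ_{k+1}|` ((46) p. 267): one factor
`g_k` of the amplitude (25) absorbs `r(g_k)²` (`NewbornJet.gcube_rsq_psq_le`, `g8_rp7_le`; `r₀ > 0`, `p₀ > 0`):
`|PY_k h U| ≤ C25·K₀(32,6)·(20(cB/ρ)²·tl(2r₀,1) + Cfar·b₀⁵·tl(7r₀+5p₀,6))·(g_kp(g_k))²·L³·#LamFin`. [cite: Balaban1985UV3, (46) p.267] -/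
theorem newbornY46_series (hk : k ≤ S.K) (hk1 : k + 1 ≤ S.P.m + S.P.K) (κc : ChartConsts) {κ C25 : ℝ}
    (hκ : kappa₀ (4 * 2 ^ 3) (2 * 3) ≤ κ) (hC25 : 0 ≤ C25) (hb₀ : 0 ≤ B.b₀) (hp₀ : 0 < B.p₀) (hr₀ : 0 < κc.r₀)
    (hN : Nc k = max 1 (S.P.sitesPerDir k / B.M₁))
    (chart : ∀ X, ChartAnalyticityAsCited ((𝔖 k).Ψ X) κc.ρ
      (C25 * S.gk k * Real.exp (-(κ * (tsys 3 (Nc k)).dj X))))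
    (bound28 : ∀ X h U, ‖(𝔖 k).Bcfg X h U‖ ≤ κc.cB * (rFun κc.r₀ (S.gk k) * S.gk k * pFun B.b₀ B.p₀ (S.gk k)))
    (small28 : κc.cB * (rFun κc.r₀ (S.gk k) * S.gk k * pFun B.b₀ B.p₀ (S.gk k)) ≤ κc.ρ / 4)
    (far_le : FarTermsDecayAsCited (𝔖 k).far (fun X => C25 * S.gk k * Real.exp (-(κ * (tsys 3 (Nc k)).dj X)))
      κc.Cfar (S.gk k ^ 7 * (rFun κc.r₀ (S.gk k) * pFun B.b₀ B.p₀ (S.gk k)) ^ 7))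
    (hPY : ∀ h U, (𝔖 k).PY h U
      = ∑ X ∈ (𝔖 k).loc (ΩblkOf B.M₁ B.Rcol (Nc k)) (B.Rret k) h,
          ((jet26 ((𝔖 k).Ψ X) ((𝔖 k).Bcfg X h U)).re - (𝔖 k).far X h U))
    (h : Hist S.P (k + 1)) (U : GaugeField S.P (k + 1) G) :
    |(𝔖 k).PY h U|
      ≤ C25 * K₀ (4 * 2 ^ 3) (2 * 3)
          * (20 * (κc.cB / κc.ρ) ^ 2 * tlConst (2 * κc.r₀) 1
              + κc.Cfar * (B.b₀ ^ 5 * tlConst (7 * κc.r₀ + 5 * B.p₀) 6))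
          * ((S.gk k * pFun B.b₀ B.p₀ (S.gk k)) ^ 2 * ((L : ℝ) ^ 3 * ((LamFin B.M₁ B.Rcol k h).card : ℝ))) := by
  have hg0 : 0 < S.gk k := gk_pos S k
  have hg1 : S.gk k ≤ 1 := gk_le_one S S.gK_le_one k hk
  have hY := abs_PY_le_series B 𝔖 k hk hk1 κc hκ hC25 hb₀ hN chart bound28 small28 far_le hPY h U
  refine hY.trans ?_
  set g := S.gk k with hg
  set r := rFun κc.r₀ g
  set p := pFun B.b₀ B.p₀ g
  set V : ℝ := (L : ℝ) ^ 3 * ((LamFin B.M₁ B.Rcol k h).card : ℝ) with hV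
  have hV0 : 0 ≤ V := by positivity
  have hK := K₀_pos (4 * 2 ^ 3) (2 * 3)
  -- the two power countings
  have h1 : g ^ 3 * r ^ 2 * p ^ 2 ≤ tlConst (2 * κc.r₀) 1 * (g ^ 2 * p ^ 2) :=
    gcube_rsq_psq_le κc.r₀ B.b₀ B.p₀ g hr₀ hg0 hg1
  have h2 : g ^ 8 * (r * p) ^ 7 ≤ B.b₀ ^ 5 * tlConst (7 * κc.r₀ + 5 * B.p₀) 6 * (g ^ 2 * p ^ 2) :=
    g8_rp7_le κc.r₀ B.b₀ B.p₀ g (by linarith) hb₀ hg0 hg1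
  have hρ := κc.ρ_pos
  have hcB := κc.cB_nonneg
  have hCf := κc.Cfar_nonneg
  -- rewrite the exact currency as (coefficients) × the two monomials
  have hlhs : (20 * (κc.cB * (r * g * p) / κc.ρ) ^ 2 + κc.Cfar * (g ^ 7 * (r * p) ^ 7))
        * ((C25 * g) * K₀ (4 * 2 ^ 3) (2 * 3) * V)
      = C25 * K₀ (4 * 2 ^ 3) (2 * 3) * V
          * (20 * (κc.cB / κc.ρ) ^ 2 * (g ^ 3 * r ^ 2 * p ^ 2) + κc.Cfar * (g ^ 8 * (r * p) ^ 7)) := by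
    ring
  have hrhs : C25 * K₀ (4 * 2 ^ 3) (2 * 3)
        * (20 * (κc.cB / κc.ρ) ^ 2 * tlConst (2 * κc.r₀) 1
            + κc.Cfar * (B.b₀ ^ 5 * tlConst (7 * κc.r₀ + 5 * B.p₀) 6)) * ((g * p) ^ 2 * V)
      = C25 * K₀ (4 * 2 ^ 3) (2 * 3) * V
          * (20 * (κc.cB / κc.ρ) ^ 2 * (tlConst (2 * κc.r₀) 1 * (g ^ 2 * p ^ 2))
            + κc.Cfar * (B.b₀ ^ 5 * tlConst (7 * κc.r₀ + 5 * B.p₀) 6 * (g ^ 2 * p ^ 2))) := by ring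
  rw [hlhs, hrhs]
  refine mul_le_mul_of_nonneg_left (add_le_add ?_ ?_) (by positivity)
  · exact mul_le_mul_of_nonneg_left h1 (by positivity)
  · exact mul_le_mul_of_nonneg_left h2 hCf

/-- **The (61)-born newborn terms in the currency the inputs give**, `(r(g_k)g_kp(g_k))²·|Λ_{k+1}|` — print's (46)
TIMES `r(g_k)²` (lane FINDING; `NewbornJet.g7_rp7_le` for the far part): `|PYZ_k h U| ≤ C63·K₀(32,6)·(20(cB/ρ)² +
Cfar·b₀⁵·tl(5r₀+5p₀,5))·(r(g_k)g_kp(g_k))²·L³·#LamFin`. [cite: Balaban1985UV3, (46) p.267 + p.265 L14–16] -/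
theorem newbornZ46r_series (hk : k ≤ S.K) (hk1 : k + 1 ≤ S.P.m + S.P.K) (κc : ChartConsts) {κ C63 : ℝ}
    (hκ : kappa₀ (4 * 2 ^ 3) (2 * 3) ≤ κ) (hC63 : 0 ≤ C63) (hb₀ : 0 ≤ B.b₀) (hp₀ : 0 < B.p₀) (hr₀ : 0 < κc.r₀)
    (hN : Nc k = max 1 (S.P.sitesPerDir k / B.M₁))
    (bound28 : ∀ X h U, ‖(𝔖 k).Bcfg X h U‖ ≤ κc.cB * (rFun κc.r₀ (S.gk k) * S.gk k * pFun B.b₀ B.p₀ (S.gk k)))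
    (small28 : κc.cB * (rFun κc.r₀ (S.gk k) * S.gk k * pFun B.b₀ B.p₀ (S.gk k)) ≤ κc.ρ / 4)
    (Λ : LogZLocalization (B.withSeries 𝔖 C).tower3.toTowerRun k (𝔖 k).E κc κ C63
      (seriesPieces B 𝔖 C k).logZU (seriesPieces B 𝔖 C k).logZ1 (𝔖 k).Bcfg
      (fun h => Finset.univ.filter fun X : (tsys 3 (Nc k)).Dom => X.1 ⊆ ΩblkOf B.M₁ B.Rcol (Nc k) h))
    (hPYZ : ∀ h U, (𝔖 k).PYZ h U
      = ∑ X ∈ (𝔖 k).loc (ΩblkOf B.M₁ B.Rcol (Nc k)) (B.Rret k) h,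
          ((jet26 (Λ.Ψ X) ((𝔖 k).Bcfg X h U)).re - Λ.far X h U))
    (h : Hist S.P (k + 1)) (U : GaugeField S.P (k + 1) G) :
    |(𝔖 k).PYZ h U|
      ≤ C63 * K₀ (4 * 2 ^ 3) (2 * 3)
          * (20 * (κc.cB / κc.ρ) ^ 2 + κc.Cfar * (B.b₀ ^ 5 * tlConst (5 * κc.r₀ + 5 * B.p₀) 5))
          * ((rFun κc.r₀ (S.gk k) * S.gk k * pFun B.b₀ B.p₀ (S.gk k)) ^ 2
              * ((L : ℝ) ^ 3 * ((LamFin B.M₁ B.Rcol k h).card : ℝ))) := by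
  have hg0 : 0 < S.gk k := gk_pos S k
  have hg1 : S.gk k ≤ 1 := gk_le_one S S.gK_le_one k hk
  have hZ := abs_PYZ_le_series B 𝔖 C k hk hk1 κc hκ hC63 hb₀ hN bound28 small28 Λ hPYZ h U
  refine hZ.trans ?_
  set g := S.gk k with hg
  set r := rFun κc.r₀ g
  set p := pFun B.b₀ B.p₀ g
  set V : ℝ := (L : ℝ) ^ 3 * ((LamFin B.M₁ B.Rcol k h).card : ℝ) with hV
  have hV0 : 0 ≤ V := by positivity
  have hK := K₀_pos (4 * 2 ^ 3) (2 * 3)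
  have h2 : g ^ 7 * (r * p) ^ 7 ≤ B.b₀ ^ 5 * tlConst (5 * κc.r₀ + 5 * B.p₀) 5 * (r * g * p) ^ 2 :=
    g7_rp7_le κc.r₀ B.b₀ B.p₀ g (by linarith) hb₀ hg0 hg1
  have hρ := κc.ρ_pos
  have hcB := κc.cB_nonneg
  have hCf := κc.Cfar_nonneg
  have hlhs : (20 * (κc.cB * (r * g * p) / κc.ρ) ^ 2 + κc.Cfar * (g ^ 7 * (r * p) ^ 7))
        * (C63 * K₀ (4 * 2 ^ 3) (2 * 3) * V)
      = C63 * K₀ (4 * 2 ^ 3) (2 * 3) * V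
          * (20 * (κc.cB / κc.ρ) ^ 2 * (r * g * p) ^ 2 + κc.Cfar * (g ^ 7 * (r * p) ^ 7)) := by
    ring
  have hrhs : C63 * K₀ (4 * 2 ^ 3) (2 * 3)
        * (20 * (κc.cB / κc.ρ) ^ 2 + κc.Cfar * (B.b₀ ^ 5 * tlConst (5 * κc.r₀ + 5 * B.p₀) 5))
        * ((r * g * p) ^ 2 * V)
      = C63 * K₀ (4 * 2 ^ 3) (2 * 3) * V
          * (20 * (κc.cB / κc.ρ) ^ 2 * (r * g * p) ^ 2
            + κc.Cfar * (B.b₀ ^ 5 * tlConst (5 * κc.r₀ + 5 * B.p₀) 5 * (r * g * p) ^ 2)) := by ring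
  rw [hlhs, hrhs]
  refine mul_le_mul_of_nonneg_left (add_le_add le_rfl ?_) (by positivity)
  exact mul_le_mul_of_nonneg_left h2 hCf

end Series

end Summit.QuantumFields.Balaban3D.Proofs.Run3Newborn

end
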